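import Mathlib
import Literature.RepresentationTheory.FiniteGroups.IsotypicProjector
import Summits.MatrixMultiplication.MatrixMultiplication.Theses.LevelGradedCohnUmans
import Summits.MatrixMultiplication.MatrixMultiplication.Theorems.LevelGradedCohnUmansLevelOneLinkPermModule

/-!
# `LevelOneLink`: level-one `GL₂(𝔽_p)` designs feed the Lie engine

Route `MatrixMultiplication/LevelGradedCohnUmans`, support item `stmt-MatrixMultiplication-14082`
(`Summit.MatrixMultiplication.MatrixMultiplication.Theses.LevelGradedCohnUmans.LevelOneLink`:
`LevelOneGL2Designs → LieRankDesigns`).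

## Proof

* **Level-one budget of `GL₂(𝔽_p)`** (`LevelOneLink.levelOne_budget_le`): for `s ≥ 1`,
  `∑ᶠ_{χ ∈ Irr(GL₂(𝔽_p)) ∩ F₁} χ(1)^s ≤ (p + 1)^{s-1} p²`, where `F₁` is the Fourier-rank-`≤ 1` test
  space `{g ↦ ∑_{rk M ≤ 1} c_M ψ(tr(M g))}`.  A rank-`≤ 1` matrix is an outer product `a bᵀ`
  (`exists_eq_vecMulVec_of_rank_le_one`) and `tr(a bᵀ g) = b ⬝ (g a)` (`trace_vecMulVec_mul`), so
  an irreducible `χ ∈ F₁` is a sum of functions of single matrix–vector products `g a`; by the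
  permutation-module lemmas of `LevelGradedCohnUmansLevelOneLinkPermModule` its representation
  has a `Stab(a)`-fixed vector, hence is an equivariant quotient of `ℂ[𝔽_p²]`: its degree is at
  most the number `p + 1` of line representatives `(1,0), (t,1)` (central scalars move them onto
  `𝔽_p² ∖ 0`, `exists_scalar_smul_eq`; the orbit `{0}` needs one), and the degrees of distinct such
  `χ` add up to at most `dim ℂ[𝔽_p²] = p²` (isotypic projectors).  Hence
  `∑ χ(1)^s ≤ (p+1)^{s-1} · p²`.
* **ε-bookkeeping** (`levelOneLink_proof`, the crux chain's `LieRankDesigns_of_levelOneGL2` with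
  constant `4`): for `s = 2 + ε` and `p > ((4/c)^s)^{2/ε}` in the design family,
  `(p+1)^{s-1} p² ≤ 4^s p^{1+s} < c^s p^{3s/2} ≤ (|X||Y||Z|)^{s/3}`.
-/

-- `Summit.<Summit>.<Problem>` is the tree's mandated summit-side namespace; for this
-- single-conjunct summit the two coincide, so the file silences `dupNamespace`.
set_option linter.dupNamespace false

noncomputable section

open scoped BigOperators
open Module Literature.RepresentationTheory.FiniteGroups


/-! ## The level-one budget of `GL₂(𝔽_p)` -/

namespace Summit.MatrixMultiplication.MatrixMultiplication.Theorems.LevelOneLink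

open Matrix

/-- A matrix of rank `≤ 1` over a field is an outer product `a bᵀ`. [folklore] -/
theorem exists_eq_vecMulVec_of_rank_le_one {K : Type*} [Field K] {m n : Type*} [Fintype m]
    [Fintype n] [DecidableEq n] (M : Matrix m n K) (hM : M.rank ≤ 1) :
    ∃ (a : m → K) (b : n → K), M = Matrix.vecMulVec a b := by
  obtain ⟨v, hv⟩ := finrank_le_one_iff.1 hM
  have hcol : ∀ j, ∃ c : K, c • (v : m → K) = M.col j := by
    intro j
    have hmem : M.col j ∈ LinearMap.range M.mulVecLin :=
      ⟨Pi.single j 1, by rw [Matrix.mulVecLin_apply, Matrix.mulVec_single_one]⟩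
    obtain ⟨c, hc⟩ := hv ⟨M.col j, hmem⟩
    exact ⟨c, by simpa using congrArg Subtype.val hc⟩
  choose c hc using hcol
  refine ⟨v, c, ?_⟩
  ext i j
  have h := congrFun (hc j) i
  simp only [Pi.smul_apply, smul_eq_mul, Matrix.col_apply] at h
  rw [Matrix.vecMulVec_apply, ← h, mul_comm]

/-- `tr(a bᵀ g) = b ⬝ (g a)`: a rank-one exponential `ψ(tr(M g))` is a function of the single
matrix–vector product `g a`. [folklore] -/
theorem trace_vecMulVec_mul {K : Type*} [CommSemiring K] {n : Type*} [Fintype n]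
    (a b : n → K) (g : Matrix n n K) :
    Matrix.trace (Matrix.vecMulVec a b * g) = b ⬝ᵥ (g *ᵥ a) := by
  rw [Matrix.vecMulVec_mul, Matrix.trace_vecMulVec, dotProduct_comm, ← Matrix.dotProduct_mulVec]

section GL2

variable (p : ℕ) [Fact p.Prime]

/-- Scalar matrices act on vectors by scalars. [folklore] -/
theorem scalar_smul_eq (t : (ZMod p)ˣ) (r : Fin 2 → ZMod p) :
    (Matrix.GeneralLinearGroup.scalar (Fin 2) t) • r = (t : ZMod p) • r := by
  rw [Units.smul_def, Matrix.GeneralLinearGroup.coe_scalar, Matrix.smul_eq_mulVec,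
    Matrix.scalar_apply]
  funext i
  rw [Matrix.mulVec_diagonal, Pi.smul_apply, smul_eq_mul]

/-- Scalar matrices are central in `GL₂`. [folklore] -/
theorem scalar_mem_center (t : (ZMod p)ˣ) :
    Matrix.GeneralLinearGroup.scalar (Fin 2) t ∈
      Submonoid.center (Matrix.GeneralLinearGroup (Fin 2) (ZMod p)) :=
  Submonoid.mem_center_iff.2 fun g => (Matrix.GeneralLinearGroup.scalar_commute t g).symm

/-- **Line representatives**: the `p + 1` vectors `(1,0)`, `(t,1)` (`t ∈ 𝔽_p`) reach every
non-zero vector of `𝔽_p²` under the central (scalar) subgroup of `GL₂(𝔽_p)`. [folklore] -/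
theorem exists_scalar_smul_eq {u : Fin 2 → ZMod p} (hu : u ≠ 0) :
    ∃ r ∈ insert (![1, 0] : Fin 2 → ZMod p) (Finset.univ.image fun t : ZMod p => ![t, 1]),
      ∃ z : Matrix.GeneralLinearGroup (Fin 2) (ZMod p),
        z ∈ Submonoid.center (Matrix.GeneralLinearGroup (Fin 2) (ZMod p)) ∧ z • r = u := by
  by_cases h1 : u 1 = 0
  · have h0 : u 0 ≠ 0 := by
      intro h0
      apply hu
      funext i
      fin_cases i
      · exact h0
      · exact h1
    refine ⟨![1, 0], Finset.mem_insert_self _ _,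
      Matrix.GeneralLinearGroup.scalar (Fin 2) (Units.mk0 (u 0) h0), scalar_mem_center p _, ?_⟩
    rw [scalar_smul_eq]
    funext i
    fin_cases i
    · simp
    · simp [h1]
  · refine ⟨![u 0 / u 1, 1], Finset.mem_insert_of_mem
        (Finset.mem_image_of_mem _ (Finset.mem_univ (u 0 / u 1))),
      Matrix.GeneralLinearGroup.scalar (Fin 2) (Units.mk0 (u 1) h1), scalar_mem_center p _, ?_⟩
    rw [scalar_smul_eq]
    funext i
    fin_cases i
    · simp only [Units.val_mk0, Pi.smul_apply, smul_eq_mul]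
      simp only [Fin.zero_eta, Matrix.cons_val_zero]
      field_simp
    · simp

/-- The line representatives are at most `p + 1` in number. [folklore] -/
theorem card_lineReps_le :
    (insert (![1, 0] : Fin 2 → ZMod p)
        (Finset.univ.image fun t : ZMod p => ![t, 1])).card ≤ p + 1 := by
  refine (Finset.card_insert_le _ _).trans ?_
  have h := (Finset.card_image_le (s := (Finset.univ : Finset (ZMod p)))
    (f := fun t : ZMod p => (![t, 1] : Fin 2 → ZMod p)))
  rw [Finset.card_univ, ZMod.card] at h
  omega

/-- **Orbit cover in `𝔽_p²`**: for the stabiliser point `a` of a level-one character, either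
`a = 0` (orbit `{0}`, covered by `R = {0}`) or `a ≠ 0` (orbit `𝔽_p² ∖ {0}`, covered by the `p + 1`
line representatives and central scalars); in both cases a cover of size `≤ p + 1` in the sense of
`finrank_le_card_of_cover`. [folklore] -/
theorem exists_cover_card_le (a : Fin 2 → ZMod p) :
    ∃ R : Finset (Fin 2 → ZMod p), R.card ≤ p + 1 ∧
      ∀ u : Fin 2 → ZMod p, (∀ g : Matrix.GeneralLinearGroup (Fin 2) (ZMod p), g • a ≠ u) ∨
        ∃ r ∈ R, ∃ z : Matrix.GeneralLinearGroup (Fin 2) (ZMod p),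
          z ∈ Submonoid.center (Matrix.GeneralLinearGroup (Fin 2) (ZMod p)) ∧ z • r = u := by
  by_cases ha : a = 0
  · refine ⟨{0}, by rw [Finset.card_singleton]; omega, fun u => ?_⟩
    by_cases hu : u = 0
    · exact Or.inr ⟨0, Finset.mem_singleton_self _, 1, Submonoid.one_mem _, by rw [one_smul, hu]⟩
    · refine Or.inl fun g hg => hu ?_
      rw [← hg, ha, Units.smul_def, Matrix.smul_eq_mulVec, Matrix.mulVec_zero]
  · refine ⟨_, card_lineReps_le p, fun u => ?_⟩
    by_cases hu : u = 0
    · refine Or.inl fun g hg => ha ?_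
      rw [hu, smul_eq_iff_eq_inv_smul] at hg
      rw [hg, Units.smul_def, Matrix.smul_eq_mulVec, Matrix.mulVec_zero]
    · exact Or.inr (exists_scalar_smul_eq p hu)

/-- **Degree and multiplicity of a level-one irreducible character of `GL₂(𝔽_p)`.** If an
irreducible character `χ` of `GL₂(𝔽_p)` lies in the Fourier-rank-`≤ 1` test space
`F₁ = {g ↦ ∑_{rk M ≤ 1} c_M ψ(tr(M g))}`, then `χ(1) = d` with `d ≤ p + 1` and `d ≤ rk P_χ`, where
`P_χ` is the `χ`-isotypic projector of the permutation representation of `GL₂(𝔽_p)` on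
`ℂ[𝔽_p²]` (every rank-`≤ 1` exponential is a function of one matrix–vector product `g a`, so
`χ` has a `Stab(a)`-fixed vector: `ρ_χ` is a quotient of `ℂ[𝔽_p²]` spanned by the images of
`≤ p + 1` lines). [folklore] -/
theorem exists_degree_le {χ : Matrix.GeneralLinearGroup (Fin 2) (ZMod p) → ℂ}
    (hχ : χ ∈ irrChars (Matrix.GeneralLinearGroup (Fin 2) (ZMod p)))
    (hF : ∃ c : Matrix (Fin 2) (Fin 2) (ZMod p) → ℂ, (∀ M, 1 < M.rank → c M = 0) ∧
      ∀ g : Matrix.GeneralLinearGroup (Fin 2) (ZMod p), χ g =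
        ∑ M : Matrix (Fin 2) (Fin 2) (ZMod p), c M *
          ZMod.stdAddChar (Matrix.trace (M * (g : Matrix (Fin 2) (Fin 2) (ZMod p))))) :
    ∃ d : ℕ, χ 1 = d ∧ d ≤ p + 1 ∧
      d ≤ finrank ℂ (LinearMap.range (isotypicProj
        (Representation.ofMulAction ℂ (Matrix.GeneralLinearGroup (Fin 2) (ZMod p))
          (Fin 2 → ZMod p)) χ)) := by
  classical
  obtain ⟨V, _, _, _, ρ, hρ, rfl⟩ := hχ
  obtain ⟨c, hc, hcg⟩ := hF
  -- factor the rank `≤ 1` matrices as outer products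
  have hfac : ∀ M : Matrix (Fin 2) (Fin 2) (ZMod p), ∃ a b : Fin 2 → ZMod p,
      M.rank ≤ 1 → M = Matrix.vecMulVec a b := by
    intro M
    by_cases h : M.rank ≤ 1
    · obtain ⟨a, b, hab⟩ := exists_eq_vecMulVec_of_rank_le_one M h
      exact ⟨a, b, fun _ => hab⟩
    · exact ⟨0, 0, fun h' => absurd h' h⟩
  choose a b hab using hfac
  -- the character as a sum of functions of one matrix–vector product
  have hsum : ∀ g : Matrix.GeneralLinearGroup (Fin 2) (ZMod p), ρ.character g =
      ∑ M : Matrix (Fin 2) (Fin 2) (ZMod p),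
        (fun u : Fin 2 → ZMod p => c M * ZMod.stdAddChar (b M ⬝ᵥ u)) (g • a M) := by
    intro g
    rw [hcg g]
    refine Finset.sum_congr rfl fun M _ => ?_
    by_cases h : M.rank ≤ 1
    · have htr := trace_vecMulVec_mul (a M) (b M) (g : Matrix (Fin 2) (Fin 2) (ZMod p))
      rw [← hab M h] at htr
      dsimp only
      rw [htr, Units.smul_def, Matrix.smul_eq_mulVec]
    · have h0 : c M = 0 := hc M (by omega)
      simp only [h0, zero_mul]
  haveI := hρ
  obtain ⟨M₀, w, hw0, hw⟩ := exists_fixed_of_character_eq_sum ρ a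
    (fun M u => c M * ZMod.stdAddChar (b M ⬝ᵥ u)) hsum
  refine ⟨finrank ℂ V, ρ.char_one, ?_, ?_⟩
  · obtain ⟨R, hR, hcover⟩ := exists_cover_card_le p (a M₀)
    exact (finrank_le_card_of_cover ρ (a M₀) hw0 hw R hcover).trans hR
  · set Φ : (Representation.ofMulAction ℂ (Matrix.GeneralLinearGroup (Fin 2) (ZMod p))
        (Fin 2 → ZMod p)).IntertwiningMap ρ :=
      ⟨(MonoidAlgebra.basis (Fin 2 → ZMod p) ℂ).constr ℂ
          (fun u : Fin 2 → ZMod p => ∑ g : Matrix.GeneralLinearGroup (Fin 2) (ZMod p),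
            if g • a M₀ = u then ρ g w else 0),
        fun x => orbitMap_intertwining ρ (a M₀) w x⟩ with hΦ
    exact finrank_le_finrank_range_isotypicProj _ ρ Φ (orbitMap_surjective ρ (a M₀) hw0 hw) rfl

/-- **The level-one budget of `GL₂(𝔽_p)`**: for every real `s ≥ 1`,
`∑ᶠ_{χ ∈ Irr(GL₂(𝔽_p)) ∩ F₁} χ(1)^s ≤ (p + 1)^{s-1} · p²` — each such `χ` has degree `≤ p + 1`
and the degrees add up to at most `dim ℂ[𝔽_p²] = p²` (`exists_degree_le`,
`sum_finrank_range_isotypicProj_le`). (The exact value for odd `p` is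
`1 + p^s + (p - 2)(p + 1)^s`; at `s = 3` this bound reads `p⁴ + 2p³ + p²` against the exact
`p⁴ + 2p³ - 3p² - 5p - 1`; any `C^s p^{1+s}` suffices for `LevelOneLink`.) [folklore] -/
theorem levelOne_budget_le (s : ℝ) (hs : 1 ≤ s) :
    (∑ᶠ χ ∈ irrChars (Matrix.GeneralLinearGroup (Fin 2) (ZMod p)) ∩
        {f | ∃ c : Matrix (Fin 2) (Fin 2) (ZMod p) → ℂ, (∀ M, 1 < M.rank → c M = 0) ∧
          ∀ g : Matrix.GeneralLinearGroup (Fin 2) (ZMod p), f g =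
            ∑ M : Matrix (Fin 2) (Fin 2) (ZMod p), c M *
              ZMod.stdAddChar (Matrix.trace (M * (g : Matrix (Fin 2) (Fin 2) (ZMod p))))},
        (χ 1).re ^ s) ≤ ((p : ℝ) + 1) ^ (s - 1) * (p : ℝ) ^ 2 := by
  classical
  have hfin := (irrChars_finite_holds (Matrix.GeneralLinearGroup (Fin 2) (ZMod p))).subset
    (Set.inter_subset_left (t := {f | ∃ c : Matrix (Fin 2) (Fin 2) (ZMod p) → ℂ,
      (∀ M, 1 < M.rank → c M = 0) ∧
        ∀ g : Matrix.GeneralLinearGroup (Fin 2) (ZMod p), f g =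
          ∑ M : Matrix (Fin 2) (Fin 2) (ZMod p), c M *
            ZMod.stdAddChar (Matrix.trace (M * (g : Matrix (Fin 2) (Fin 2) (ZMod p))))}))
  rw [finsum_mem_eq_finite_toFinset_sum _ hfin]
  set S := hfin.toFinset with hS
  set P := Representation.ofMulAction ℂ (Matrix.GeneralLinearGroup (Fin 2) (ZMod p))
    (Fin 2 → ZMod p) with hP
  haveI : FiniteDimensional ℂ (MonoidAlgebra ℂ (Fin 2 → ZMod p)) :=
    Module.Finite.of_basis (MonoidAlgebra.basis (Fin 2 → ZMod p) ℂ)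
  have hdeg : ∀ χ ∈ S, ∃ d : ℕ, χ 1 = d ∧ d ≤ p + 1 ∧
      d ≤ finrank ℂ (LinearMap.range (isotypicProj P χ)) := fun χ hχ => by
    obtain ⟨h1, h2⟩ := hfin.mem_toFinset.1 hχ
    exact exists_degree_le p h1 h2
  choose! d hd1 hd2 hd3 using hdeg
  have hdim : finrank ℂ (MonoidAlgebra ℂ (Fin 2 → ZMod p)) = p ^ 2 := by
    rw [Module.finrank_eq_card_basis (MonoidAlgebra.basis (Fin 2 → ZMod p) ℂ),
      Fintype.card_fun, ZMod.card, Fintype.card_fin]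
  have hsumd : ∑ χ ∈ S, d χ ≤ p ^ 2 := by
    calc ∑ χ ∈ S, d χ ≤ ∑ χ ∈ S, finrank ℂ (LinearMap.range (isotypicProj P χ)) :=
          Finset.sum_le_sum fun χ hχ => hd3 χ hχ
      _ ≤ finrank ℂ (MonoidAlgebra ℂ (Fin 2 → ZMod p)) :=
          sum_finrank_range_isotypicProj_le P S fun χ hχ => (hfin.mem_toFinset.1 hχ).1
      _ = p ^ 2 := hdim
  have hp1 : (0 : ℝ) ≤ ((p : ℝ) + 1) ^ (s - 1) := by positivity
  calc ∑ χ ∈ S, (χ 1).re ^ s = ∑ χ ∈ S, (d χ : ℝ) ^ s :=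
        Finset.sum_congr rfl fun χ hχ => by rw [hd1 χ hχ, Complex.natCast_re]
    _ ≤ ∑ χ ∈ S, ((p : ℝ) + 1) ^ (s - 1) * (d χ : ℝ) := Finset.sum_le_sum fun χ hχ => by
        have hdle : (d χ : ℝ) ≤ (p : ℝ) + 1 := by exact_mod_cast hd2 χ hχ
        have h0 : (0 : ℝ) ≤ d χ := Nat.cast_nonneg _
        calc (d χ : ℝ) ^ s = (d χ : ℝ) ^ (s - 1 + 1) := by rw [sub_add_cancel]
          _ = (d χ : ℝ) ^ (s - 1) * (d χ : ℝ) ^ (1 : ℝ) :=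
              Real.rpow_add' h0 (by rw [sub_add_cancel]; linarith)
          _ = (d χ : ℝ) ^ (s - 1) * d χ := by rw [Real.rpow_one]
          _ ≤ ((p : ℝ) + 1) ^ (s - 1) * d χ := by
              gcongr
    _ = ((p : ℝ) + 1) ^ (s - 1) * ((∑ χ ∈ S, d χ : ℕ) : ℝ) := by
        rw [Nat.cast_sum, Finset.mul_sum]
    _ ≤ ((p : ℝ) + 1) ^ (s - 1) * (p : ℝ) ^ 2 := by
        refine mul_le_mul_of_nonneg_left ?_ hp1
        exact_mod_cast hsumd

end GL2

end Summit.MatrixMultiplication.MatrixMultiplication.Theorems.LevelOneLink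

/-! ## `LevelOneLink`: the smallest Lie cell is load-bearing -/

namespace Summit.MatrixMultiplication.MatrixMultiplication.Theorems

/-- **`LevelOneLink`** (route `LevelGradedCohnUmans`, item `stmt-MatrixMultiplication-14082`):
`LevelOneGL2Designs → LieRankDesigns`.  Given `ε > 0` put `s = 2 + ε` and pick, in the level-one
design family (constant `c`), a prime `p > max(3, ((4/c)^s)^{2/ε})`; take `m = 2`, `k = 1` and the
family's rank-`1`-separated triple.  Budget side: `∑ᶠ_{Irr ∩ F₁} χ(1)^s ≤ (p+1)^{s-1} p² ≤
4^s p^{1+s}` (`LevelOneLink.levelOne_budget_le`); volume side: `(|X||Y||Z|)^{s/3} ≥ (c p^{3/2})^s =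
c^s p^{1+s} p^{ε/2}`; and `4^s < c^s p^{ε/2}` by the choice of `p`.  (The ε-bookkeeping is the crux
chain's `LieRankDesigns_of_levelOneGL2`, Cruxes/LieRankDesigns/IdeatorSketch2.lean, with the
constant `2` replaced by `4`.) -/
theorem levelOneLink_proof :
    Summit.MatrixMultiplication.MatrixMultiplication.Theses.LevelGradedCohnUmans.LevelOneLink := by
  intro hdesign ε hε
  obtain ⟨c, hc, hall⟩ := hdesign
  set s : ℝ := 2 + ε with hs_def
  have hs : 0 < s := by rw [hs_def]; linarith
  have hs1 : 1 ≤ s := by rw [hs_def]; linarith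
  set K : ℝ := (4 / c) ^ s with hK_def
  have hK : 0 ≤ K := by rw [hK_def]; positivity
  obtain ⟨N, hN⟩ := exists_nat_gt (max 3 (K ^ (2 / ε)))
  obtain ⟨p, hprime, hNp, X, Y, Z, hsep, hX, hY, hZ⟩ := hall N
  have hNR : (N : ℝ) ≤ p := by exact_mod_cast hNp
  have hp3 : (3 : ℝ) < p := lt_of_lt_of_le (lt_of_le_of_lt (le_max_left _ _) hN) hNR
  have hpK : K ^ (2 / ε) < p := lt_of_lt_of_le (lt_of_le_of_lt (le_max_right _ _) hN) hNR
  have hp0 : (0 : ℝ) < p := by linarith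
  -- the key threshold: `K < p ^ (ε/2)`
  have hKp : K < (p : ℝ) ^ (ε / 2) := by
    have h1 : (K ^ (2 / ε)) ^ (ε / 2) < (p : ℝ) ^ (ε / 2) :=
      Real.rpow_lt_rpow (by positivity) hpK (by positivity)
    have h2 : (K ^ (2 / ε)) ^ (ε / 2) = K := by
      rw [← Real.rpow_mul hK]
      have : (2 / ε) * (ε / 2) = 1 := by field_simp
      rw [this, Real.rpow_one]
    rwa [h2] at h1
  refine ⟨p, hprime, 2, 1, X, Y, Z, hsep, ?_⟩
  have hb := LevelOneLink.levelOne_budget_le p s hs1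
  -- budget: `(p+1)^(s-1) p² ≤ 4^s p^(1+s)`
  have hbud : ((p : ℝ) + 1) ^ (s - 1) * (p : ℝ) ^ 2 ≤ (4 : ℝ) ^ s * (p : ℝ) ^ (1 + s) := by
    have h1 : ((p : ℝ) + 1) ^ (s - 1) ≤ (2 * (p : ℝ)) ^ (s - 1) :=
      Real.rpow_le_rpow (by positivity) (by linarith) (by linarith)
    have h2 : (2 * (p : ℝ)) ^ (s - 1) * (p : ℝ) ^ 2 = (2 : ℝ) ^ (s - 1) * (p : ℝ) ^ (1 + s) := by
      rw [Real.mul_rpow (by norm_num) hp0.le, mul_assoc, ← Real.rpow_two, ← Real.rpow_add hp0]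
      congr 1
      ring_nf
    have h3 : (2 : ℝ) ^ (s - 1) ≤ (4 : ℝ) ^ s := by
      rw [show (4 : ℝ) = 2 ^ (2 : ℝ) by norm_num, ← Real.rpow_mul (by norm_num)]
      exact Real.rpow_le_rpow_of_exponent_le (by norm_num) (by linarith)
    have h4 : (0 : ℝ) ≤ (p : ℝ) ^ (1 + s) := Real.rpow_nonneg hp0.le _
    have h5 : (0 : ℝ) ≤ (p : ℝ) ^ 2 := by positivity
    calc ((p : ℝ) + 1) ^ (s - 1) * (p : ℝ) ^ 2 ≤ (2 * (p : ℝ)) ^ (s - 1) * (p : ℝ) ^ 2 :=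
          mul_le_mul_of_nonneg_right h1 h5
      _ = (2 : ℝ) ^ (s - 1) * (p : ℝ) ^ (1 + s) := h2
      _ ≤ (4 : ℝ) ^ s * (p : ℝ) ^ (1 + s) := mul_le_mul_of_nonneg_right h3 h4
  -- volume: `(c p^{3/2})^3 ≤ |X||Y||Z|`
  have hc32 : 0 < c * (p : ℝ) ^ (3 / 2 : ℝ) := by positivity
  have hXpos : (0 : ℝ) < X.card := lt_of_lt_of_le hc32 hX
  have hYpos : (0 : ℝ) < Y.card := lt_of_lt_of_le hc32 hY
  have hV : (c * (p : ℝ) ^ (3 / 2 : ℝ)) ^ (3 : ℕ) ≤ ((X.card * Y.card * Z.card : ℕ) : ℝ) := by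
    push_cast
    have := mul_le_mul (mul_le_mul hX hY hc32.le hXpos.le) hZ hc32.le (by positivity)
    nlinarith [this]
  have hV' : ((c * (p : ℝ) ^ (3 / 2 : ℝ)) ^ (3 : ℕ)) ^ (s / 3) ≤
      ((X.card * Y.card * Z.card : ℕ) : ℝ) ^ (s / 3) :=
    Real.rpow_le_rpow (by positivity) hV (by positivity)
  have hV'' : ((c * (p : ℝ) ^ (3 / 2 : ℝ)) ^ (3 : ℕ)) ^ (s / 3) =
      c ^ s * ((p : ℝ) ^ (1 + s) * (p : ℝ) ^ (ε / 2)) := by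
    rw [← Real.rpow_natCast, ← Real.rpow_mul hc32.le]
    have h3 : ((3 : ℕ) : ℝ) * (s / 3) = s := by push_cast; ring
    rw [h3, Real.mul_rpow hc.le (by positivity), ← Real.rpow_mul hp0.le, ← Real.rpow_add hp0]
    congr 1
    congr 1
    rw [hs_def]; ring
  -- combine
  have hfinal : (4 : ℝ) ^ s * (p : ℝ) ^ (1 + s) <
      c ^ s * ((p : ℝ) ^ (1 + s) * (p : ℝ) ^ (ε / 2)) := by
    have hcs : 0 < c ^ s := Real.rpow_pos_of_pos hc s
    have hp1s : 0 < (p : ℝ) ^ (1 + s) := Real.rpow_pos_of_pos hp0 _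
    have hKc : c ^ s * K = (4 : ℝ) ^ s := by
      rw [hK_def, Real.div_rpow (by norm_num) hc.le]
      field_simp
    calc (4 : ℝ) ^ s * (p : ℝ) ^ (1 + s) = c ^ s * ((p : ℝ) ^ (1 + s) * K) := by
          rw [← hKc]; ring
      _ < c ^ s * ((p : ℝ) ^ (1 + s) * (p : ℝ) ^ (ε / 2)) := by gcongr
  calc _ ≤ ((p : ℝ) + 1) ^ (s - 1) * (p : ℝ) ^ 2 := hb
    _ ≤ (4 : ℝ) ^ s * (p : ℝ) ^ (1 + s) := hbud
    _ < c ^ s * ((p : ℝ) ^ (1 + s) * (p : ℝ) ^ (ε / 2)) := hfinal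
    _ = ((c * (p : ℝ) ^ (3 / 2 : ℝ)) ^ (3 : ℕ)) ^ (s / 3) := hV''.symm
    _ ≤ ((X.card * Y.card * Z.card : ℕ) : ℝ) ^ (s / 3) := hV'

end Summit.MatrixMultiplication.MatrixMultiplication.Theorems

end
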